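import Summits.Parity.GeneralizedHardyLittlewood.Theses.LeeYangFibres
import Summits.Parity.GeneralizedHardyLittlewood.Theorems.LeeYangFibresAbsoluteUpgradeDipDefs
import Summits.Parity.GeneralizedHardyLittlewood.Theorems.AbsoluteUpgrade.Negative.FibreHyperbolicityAlongLoadBearing
import Summits.Parity.GeneralizedHardyLittlewood.Theorems.AbsoluteUpgrade.Negative.CellParityLawSavingLoadBearing
import Summits.Parity.GeneralizedHardyLittlewood.Theorems.PrimeCellsRelative.Negative.FalseWithoutBoxContainment
import Summits.Parity.GeneralizedHardyLittlewood.Cruxes.FibreHyperbolicity.Disproof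

/-!
# Disproof of `FibreHyperbolicityAlong` (stmt-Parity-18103, route LeeYangFibres) — standing adversary file

(cdisprove seat `refuter-cdisprove-stmt-Parity-18103-0`, cycle 1, 2026-08-17.)  Index of findings — details in the
docstrings; prose only here and there.

* `along_iff_dip`, `along_iff` — the crux IS the dip line's `DipMarginRateExchange.FibreHyperbolicityAlong`
  (`Iff.rfl`) and unfolds through `ModelTransfer.jointCell` / `fibre` at `u := slowDegree N`.
* (a) LOAD-BEARING hypotheses, each with a sorry-free `¬`:
  - mass floor `ηN ≤ β_∞𝔖` (not weakenable to `0 < β_∞𝔖`), convexity of `K`, strict positivity `0 < w_k` —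
    LANDED before this seat (`Theorems/AbsoluteUpgrade/Negative/FibreHyperbolicityAlongLoadBearing`, p113523); cited
    here as `false_without_massFloor`, `false_without_convexity`, `false_without_fugacityPositivity`;
  - NEW: box containment `K ⊆ [-N, N]` — `false_without_boxContainment` (far box `[2N, 10N]`, `β_∞ = 8N`, no lattice
    point of the box inside, zero fibre, root `I`).
* (a') DECORATIVE hypothesis: `1 ≤ t` — `slice_t_zero` / `along_iff_unguarded_t` (at `t = 0` there is no coordinate
  `i : Fin 0`, the body is vacuous; the guard can be dropped without changing the statement).
* (b) HIDDEN CONTENT (necessity): `roughTuples_of_along : FibreHyperbolicityAlong → RoughTuplesAlong` — every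
  admissible body of mass `≥ ηN` contains a lattice point at which ALL `t` forms are `N^{1/U(N)}`-rough with
  `1 ≤ Ω ≤ U(N)` (the fibre polynomial must be non-zero).  With `slowDegree_eq_four_of_le` (`U(N) = 4` for every
  `N ≤ 2^78`; in fact for `N < exp(exp 4^… )`, see the lemma) this is, at every physical `N`, a `t`-dimensional sieve
  assertion at sieve parameter `s = log N / log N^{1/4} = 4`, BELOW the sieving limit of every known `t`-dimensional
  sieve for `t ≥ 2` (`β₂ = 4.266450` DHR, `4.833987` Rosser–Iwaniec; `β₃ = 6.640859`, `β₄ = 9.072248` —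
  Diamond–Halberstam–Galway, *A Higher-Dimensional Sieve Method*, Table 17.1, read via `lit read
  book:halberstamnd-higher-dimensional-sieve-method` p. 156), hence not provable by them uniformly in the
  shifts `≤ LN` — harmless for the TRUTH of the crux (`N₀(t, L, η)` may exceed `exp(exp(4β_t²))`, where `U(N) > β_t`
  and the fundamental lemma applies), but it pins what any proof valid from a physical `N₀` on must contain.
* (c) `slowDegree_eq_four_of_log`, `slowDegree_eq_four_of_le`, `slowDegree_eq_four_of_loglog_lt`,
  `loglog_ge_of_five_le_slowDegree` — the schedule is the constant `4` exactly as long as `log log N < 100`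
  (`N < exp(exp 100)`; in particular for all `N ≤ 2^78`): every numerical fibre ever computed for this crux is a
  degree-`4` fibre, `ζ · (cubic)`, and for values `≤ N` (top cell `j_i = 4` empty) `ζ · (quadratic)`: ONE discriminant
  per fibre.
* (d) NECESSITY at `t = 1`: `modelRowAlong_of_along : crux → ModelRowAlong` (the rough-integer Ω-row
  `Σ_{j ≤ U(N)} A_j(N) z^j` is real-rooted along the schedule) and its contrapositive — parity-free, OPEN in the tree
  beyond `exp(exp 100)` (effectivity `x₀(u) ≤ exp(exp 4u²)` of the proved `ModelHyperbolicity`), numerically dead as a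
  kill (row robustness `10^{−0.41u}` ≫ secondary terms `e^{−4u²}`).
* (e) NECESSITY for primes: `Theorems/FibreHyperbolicityAlong/Negative/PrimeColumnAlong.lean` (this seat, p161599) —
  `primeColumn_hyperbolic_of_fibreHyperbolicityAlong`: along the schedule every PRIME COLUMN
  `Σ_m #{n ∈ K : Ω(ψ_i n) = m, ψ_i n rough, ψ_k n PRIME ∀ k ≠ i} ζ^m` is zero or hyperbolic; at `U = 4`, `(n, n+2)`:
  the single inequality `P₂² ≥ 4P₁P₃` (HL value of the ratio 2.05, measured 2.5).
* (T) finite-`N` noise is real along the schedule too: `slowDegree 130 = 4`, so the fixed-degree toy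
  `Cruxes/FibreHyperbolicity/Disproof.lean :: toy_fibre_nonreal` (`Ψ = (n, n+2)`, `K = [100, 130]`, cells
  `{(1,1):2,(1,2):1,(2,2):1,(3,1):1}`, discriminant `w² − 4w − 8 < 0` on `(0,1]`) is an instance of THIS crux's body at
  `N = 130`: the `∃ N₀` is load-bearing (`N₀(2, 3, 3/10) > 130`).
* NUMERICS (read, not redone): strategist census §3 (kit j024523/j024769): `(n, n+h)`, `h ∈ {2, 6, 30, 210}`,
  `N = 10⁸, 10⁹, 10¹⁰`, full interval + halves + deciles, 2 coordinates × 7 fugacities: 360/360 fibres real-rooted,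
  Newton margin `b₂²/(4b₁b₃) = 2.53 ± 0.02` (deciles ≥ 2.11) against threshold `1` and model limit
  `I₂(4)²/(4I₁I₃(4)) = 2.05`; no drift toward the threshold.  THIS SEAT: kit job (see §Numerics below when delivered)
  widening the family — `t = 3, 4` tuples, non-monic and Goldbach-type systems, primorial shifts (`𝔖` maximal),
  values in `(N, 3N]` (top cell inhabited: genuine cubic discriminants), centile windows and worst-window scans —
  DELIVERED (§(f) below, kit j026011): 1 356 555 fibres over 43 families at `N = 10⁸`, 0 non-real outside `t = 4`
  centiles with ≤ 1802 tuples; min full-window `ρ = 1.72` (`(n, n + 23#)`, cubic regime), classical families `2.53`.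
* WHY IT RESISTS (verdict of cycle 1, concurring with the strategist census `STRATEGY-CENSUS.md` §2, N1–N5):
  at the physical degree `U = 4` every fibre is `ζ·(c₁ + c₂ζ + c₃ζ² + c₄ζ³)` with `c₄/c₃ ≤ 10⁻³` (or `0`), so
  hyperbolicity is ONE inequality `c₂(w)² ≥ 4c₁(w)c₃(w)·(1 + O(c₄))`; in the Hardy–Littlewood world the cells are
  rank one up to `o(1)` (`C_j = M∏_k a_{j_k}(1+o(1))`), the inequality holds with the MODEL'S constant-factor margin
  `2.05`, uniformly in `w ∈ (0,1]^{t-1}`, shifts, scale of values (`u_eff = 4 log x/log N → 4`) and windows of mass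
  `≥ ηN`; a counterexample at arbitrarily large `N` is therefore an `Ω(1)` RELATIVE failure of Hardy–Littlewood
  equidistribution for rough almost-prime tuples (a parity ghost of amplitude `≥ θ*(4) ≈ 0.175`), which no structural
  family supplies: local obstructions are excluded by `𝔖 > 0`, identical/proportional forms by non-degeneracy or by
  `𝔖 ∈ {0, divergent}`, `toNat`/`minFac` junk by `N ≥ 16`, truncation `Ω > U` by `N > (L+1)^4`, and the only known
  source of an `Ω(1)` ghost — a Siegel zero resonant with a shift `q ≤ LN` — is itself unprovable (census N2:
  `UnboundedSiegelZeros → ¬crux`, a HOLD not a refutation).  Beyond `N ≥ exp(exp 100)` (`U ≥ 5`) the margin decays like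
  `θ*(U) ≈ e^{−0.94U}` but every structural deviation (scale drift, `1/log N` secondary terms, top cells) is
  `O(e^{−4U²}·poly(U))`, smaller.  So: no kill in ZFC short of disproving HL; the crux is sifted 2-point Chowla with an
  `e^{−cU}` saving in costume (census §2.2), true in the HL world, false in a Siegel world.
-/

noncomputable section

namespace Summit.Parity.GeneralizedHardyLittlewood.Cruxes.FibreHyperbolicityAlong.Disproof

open scoped BigOperators Classical
open MeasureTheory Literature.NumberTheory.Sieve
open Summit.Parity.GeneralizedHardyLittlewood.Theses.LeeYangFibres (FibreHyperbolicityAlong)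
open Summit.Parity.GeneralizedHardyLittlewood.Cruxes.FibreHyperbolicity.ModelTransfer (jointCell fibre)
open Summit.Parity.GeneralizedHardyLittlewood.Cruxes.AbsoluteUpgrade (DipMarginRateExchange.FibreHyperbolicityAlong)
open Summit.Parity.GeneralizedHardyLittlewood.Cruxes.AbsoluteUpgrade.DipMarginRateExchange
  (slowDegree four_le_slowDegree)
open Summit.Parity.GeneralizedHardyLittlewood.Theorems.AbsoluteUpgrade.Negative
  (fibreHyperbolicityAlong_false_without_massFloor fibreHyperbolicityAlong_false_without_mass
    fibreHyperbolicityAlong_false_without_convexity fibreHyperbolicityAlong_false_without_fugacityPositivity)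
open Summit.Parity.GeneralizedHardyLittlewood.Theorems.AbsoluteUpgrade.Negative.FibreAlong
  (fibre_eq_zero_of_forall_not_mem exists_jointCell_ne_zero_of_fibreShape isNondegenerateSystem_id affLinSize_id)
open Summit.Parity.GeneralizedHardyLittlewood.Theorems.AbsoluteUpgrade.Negative.CellSaving (realPoint_not_mem_farBox)
open Summit.Parity.GeneralizedHardyLittlewood.Theorems.PrimeCellsRelative.Negative.BoxContainment
  (archFactor_id_farBox singularProduct_id)
open Summit.Parity.GeneralizedHardyLittlewood.Cruxes.FibreHyperbolicity.Disproof
  (idSys boxK modelCell model_sum_eq_fibre idSys_isNondegenerate affLinSize_idSys convex_boxK boxK_subset_realBox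
    archMass_idSys_boxK)

/-! ## 0. The crux, read -/

/-- The crux is, definitionally, the dip line's `DipMarginRateExchange.FibreHyperbolicityAlong`. -/
theorem along_iff_dip : FibreHyperbolicityAlong ↔ DipMarginRateExchange.FibreHyperbolicityAlong := Iff.rfl

/-- The crux unfolded through `jointCell` / `fibre` at `u := slowDegree N` (definitional). -/
theorem along_iff :
    FibreHyperbolicityAlong ↔ ∀ (t L : ℕ), 1 ≤ t → ∀ η : ℝ, 0 < η → ∃ N₀ : ℕ, ∀ N : ℕ, N₀ ≤ N →
      ∀ Ψ : Fin t → AffLinForm 1, IsNondegenerateSystem Ψ → affLinSize Ψ N ≤ L →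
      ∀ K : Set (Fin 1 → ℝ), Convex ℝ K → K ⊆ realBox 1 N →
      η * (N : ℝ) ≤ archFactor Ψ K * singularProduct Ψ →
      ∀ i : Fin t, ∀ w : Fin t → ℝ, (∀ k, 0 < w k ∧ w k ≤ 1) →
      ∀ ζ : ℂ, fibre t N (slowDegree N) Ψ K i w ζ = 0 → ζ.im = 0 :=
  Iff.rfl

/-! ## (a) Load-bearing hypotheses -/

/-- The crux with the mass floor `ηN ≤ β_∞𝔖` weakened to positivity `0 < β_∞𝔖`. -/
def WithoutMassFloor : Prop :=
  ∀ (t L : ℕ), 1 ≤ t → ∃ N₀ : ℕ, ∀ N : ℕ, N₀ ≤ N →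
    ∀ Ψ : Fin t → AffLinForm 1, IsNondegenerateSystem Ψ → affLinSize Ψ N ≤ L →
    ∀ K : Set (Fin 1 → ℝ), Convex ℝ K → K ⊆ realBox 1 N →
    0 < archFactor Ψ K * singularProduct Ψ →
    ∀ i : Fin t, ∀ w : Fin t → ℝ, (∀ k, 0 < w k ∧ w k ≤ 1) →
    ∀ ζ : ℂ, fibre t N (slowDegree N) Ψ K i w ζ = 0 → ζ.im = 0

/-- **Any proof must use the mass floor quantitatively** (LANDED p113523: slab `[1/3, 2/3]`, no lattice point). -/
theorem false_without_massFloor : ¬ WithoutMassFloor := fibreHyperbolicityAlong_false_without_massFloor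

/-- The crux with convexity of `K` dropped. -/
def WithoutConvexity : Prop :=
  ∀ (t L : ℕ), 1 ≤ t → ∀ η : ℝ, 0 < η → ∃ N₀ : ℕ, ∀ N : ℕ, N₀ ≤ N →
    ∀ Ψ : Fin t → AffLinForm 1, IsNondegenerateSystem Ψ → affLinSize Ψ N ≤ L →
    ∀ K : Set (Fin 1 → ℝ), K ⊆ realBox 1 N →
    η * (N : ℝ) ≤ archFactor Ψ K * singularProduct Ψ →
    ∀ i : Fin t, ∀ w : Fin t → ℝ, (∀ k, 0 < w k ∧ w k ≤ 1) →
    ∀ ζ : ℂ, fibre t N (slowDegree N) Ψ K i w ζ = 0 → ζ.im = 0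

/-- **Any proof must use convexity of `K`** (LANDED p113523: `[-N,N] ∖ ℤ`, full mass, zero fibre). -/
theorem false_without_convexity : ¬ WithoutConvexity := fibreHyperbolicityAlong_false_without_convexity

/-- The crux with the frozen fugacities allowed on the closed cube `[0,1]^t`. -/
def WithClosedFugacities : Prop :=
  ∀ (t L : ℕ), 1 ≤ t → ∀ η : ℝ, 0 < η → ∃ N₀ : ℕ, ∀ N : ℕ, N₀ ≤ N →
    ∀ Ψ : Fin t → AffLinForm 1, IsNondegenerateSystem Ψ → affLinSize Ψ N ≤ L →
    ∀ K : Set (Fin 1 → ℝ), Convex ℝ K → K ⊆ realBox 1 N →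
    η * (N : ℝ) ≤ archFactor Ψ K * singularProduct Ψ →
    ∀ i : Fin t, ∀ w : Fin t → ℝ, (∀ k, 0 ≤ w k ∧ w k ≤ 1) →
    ∀ ζ : ℂ, fibre t N (slowDegree N) Ψ K i w ζ = 0 → ζ.im = 0

/-- **Any proof must use `0 < w_k` strictly** (LANDED p113523: twins at `w = (1, 0)`, zero fibre); the node
`w → 0⁺` ("the other forms prime") is a limit, never a point, of the statement. -/
theorem false_with_closedFugacities : ¬ WithClosedFugacities :=
  fibreHyperbolicityAlong_false_without_fugacityPositivity

/-- The crux with the box containment `K ⊆ [-N, N]` dropped (NEW variant of this seat). -/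
def WithoutBoxContainment : Prop :=
  ∀ (t L : ℕ), 1 ≤ t → ∀ η : ℝ, 0 < η → ∃ N₀ : ℕ, ∀ N : ℕ, N₀ ≤ N →
    ∀ Ψ : Fin t → AffLinForm 1, IsNondegenerateSystem Ψ → affLinSize Ψ N ≤ L →
    ∀ K : Set (Fin 1 → ℝ), Convex ℝ K →
    η * (N : ℝ) ≤ archFactor Ψ K * singularProduct Ψ →
    ∀ i : Fin t, ∀ w : Fin t → ℝ, (∀ k, 0 < w k ∧ w k ≤ 1) →
    ∀ ζ : ℂ, fibre t N (slowDegree N) Ψ K i w ζ = 0 → ζ.im = 0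

/-- **Box containment is load-bearing (NEW).** Without `K ⊆ [-N, N]`, at `t = 1`, `L = 1`, `η = 1`: the system
`ψ(n) = n` (`𝔖 = 1`) on the far box `K = [2N, 10N]` (convex, `β_∞ = 8N ≥ ηN`) contains NO lattice point of
`[-N, N]`, every joint cell is `0`, the fibre is the zero polynomial and `ζ = I` is a non-real zero.  The statement
sees `K` through the measure `β_∞` but the cells through `K ∩ ℤ ∩ [-N, N]`; the containment is what ties them
(same witness as for `CellParityLawSaving`, p114876, and `PrimeCellsRelative`). [folklore] -/
theorem false_without_boxContainment : ¬ WithoutBoxContainment := by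
  intro h
  obtain ⟨N₀, hN₀⟩ := h 1 1 le_rfl 1 one_pos
  have h1 : 1 ≤ max N₀ 1 := le_max_right _ _
  have hb := hN₀ (max N₀ 1) (le_max_left _ _) (fun _ => ⟨fun _ => 1, 0⟩) isNondegenerateSystem_id
    (affLinSize_id _) (Set.Icc (fun _ : Fin 1 => (2 * (max N₀ 1 : ℕ) : ℝ)) (fun _ => 10 * (max N₀ 1 : ℕ)))
    (convex_Icc _ _) ?_ 0 (fun _ => 1) (fun _ => ⟨one_pos, le_rfl⟩) Complex.I
    (fibre_eq_zero_of_forall_not_mem _ (fun n hn => realPoint_not_mem_farBox h1 hn) _ _ _)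
  · simp at hb
  · rw [archFactor_id_farBox, singularProduct_id]
    push_cast
    have : (1 : ℝ) ≤ max (N₀ : ℝ) 1 := le_max_right _ _
    nlinarith

/-! ## (a') The guard `1 ≤ t` is decorative -/

/-- At `t = 0` the body of the crux holds trivially: there is no coordinate `i : Fin 0` to free. -/
theorem slice_t_zero (L : ℕ) (η : ℝ) : ∃ N₀ : ℕ, ∀ N : ℕ, N₀ ≤ N →
    ∀ Ψ : Fin 0 → AffLinForm 1, IsNondegenerateSystem Ψ → affLinSize Ψ N ≤ L →
    ∀ K : Set (Fin 1 → ℝ), Convex ℝ K → K ⊆ realBox 1 N →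
    η * (N : ℝ) ≤ archFactor Ψ K * singularProduct Ψ →
    ∀ i : Fin 0, ∀ w : Fin 0 → ℝ, (∀ k, 0 < w k ∧ w k ≤ 1) →
    ∀ ζ : ℂ, fibre 0 N (slowDegree N) Ψ K i w ζ = 0 → ζ.im = 0 :=
  ⟨0, fun _ _ _ _ _ _ _ _ _ i => i.elim0⟩

/-- Hence the crux is equivalent to its `t`-unguarded form (information for the planner: `1 ≤ t` can go). -/
theorem along_iff_unguarded_t :
    FibreHyperbolicityAlong ↔ ∀ (t L : ℕ) (η : ℝ), 0 < η → ∃ N₀ : ℕ, ∀ N : ℕ, N₀ ≤ N →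
      ∀ Ψ : Fin t → AffLinForm 1, IsNondegenerateSystem Ψ → affLinSize Ψ N ≤ L →
      ∀ K : Set (Fin 1 → ℝ), Convex ℝ K → K ⊆ realBox 1 N →
      η * (N : ℝ) ≤ archFactor Ψ K * singularProduct Ψ →
      ∀ i : Fin t, ∀ w : Fin t → ℝ, (∀ k, 0 < w k ∧ w k ≤ 1) →
      ∀ ζ : ℂ, fibre t N (slowDegree N) Ψ K i w ζ = 0 → ζ.im = 0 := by
  constructor
  · intro h t L η hη
    rcases Nat.eq_zero_or_pos t with rfl | ht
    · exact slice_t_zero L η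
    · exact h t L ht η hη
  · intro h t L _ η hη
    exact h t L η hη

/-! ## (b) Hidden content: rough `t`-tuples in every admissible body -/

/-- **Rough tuples along the schedule**: for `N ≥ N₀(t, L, η)`, every admissible `(Ψ, K)` of mass `≥ ηN` has a
lattice point `n ∈ K ∩ [-N, N]` at which every `ψ_k(n)` is `N^{1/U(N)}`-rough with `1 ≤ Ω(ψ_k(n)) ≤ U(N)`.
A `t`-dimensional sieve EXISTENCE statement at sieve parameter `s = U(N)` (`= 4` for every `N ≤ 2^78`,
`slowDegree_eq_four_of_le`), i.e. below the sieving limit `β_t` of the known `t`-dimensional sieves for `t ≥ 2`;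
heuristically true (expected count `≍ η 𝔖⁻¹… N (4e^{-γ}/log N)^t·𝔖`). -/
def RoughTuplesAlong : Prop :=
  ∀ (t L : ℕ), 1 ≤ t → ∀ η : ℝ, 0 < η → ∃ N₀ : ℕ, ∀ N : ℕ, N₀ ≤ N →
    ∀ Ψ : Fin t → AffLinForm 1, IsNondegenerateSystem Ψ → affLinSize Ψ N ≤ L →
    ∀ K : Set (Fin 1 → ℝ), Convex ℝ K → K ⊆ realBox 1 N →
    η * (N : ℝ) ≤ archFactor Ψ K * singularProduct Ψ →
    ∃ n ∈ latticeBox 1 N, realPoint n ∈ K ∧ ∀ k,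
      (N : ℝ) ^ ((1 : ℝ) / (slowDegree N : ℕ)) < (Nat.minFac ((Ψ k).eval n).toNat : ℝ) ∧
      1 ≤ ArithmeticFunction.cardFactors ((Ψ k).eval n).toNat ∧
      ArithmeticFunction.cardFactors ((Ψ k).eval n).toNat ≤ slowDegree N

/-- **The crux contains `RoughTuplesAlong`** (the fibre at `w = (1,…,1)` must be a non-zero polynomial, else
`ζ = I` is a root). [folklore] -/
theorem roughTuples_of_along (h : FibreHyperbolicityAlong) : RoughTuplesAlong := by
  intro t L ht η hη
  obtain ⟨N₀, hN₀⟩ := h t L ht η hη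
  refine ⟨N₀, fun N hN Ψ hΨ hL K hK hKN hmass => ?_⟩
  have hfib := hN₀ N hN Ψ hΨ hL K hK hKN hmass ⟨0, ht⟩ (fun _ => 1) (fun _ => ⟨one_pos, le_rfl⟩)
  obtain ⟨j, hj, hne⟩ := exists_jointCell_ne_zero_of_fibreShape hfib
  obtain ⟨n, hn⟩ := Finset.card_ne_zero.mp hne
  rw [Finset.mem_filter] at hn
  refine ⟨n, hn.1, hn.2.1, fun k => ⟨(hn.2.2 k).1, ?_, ?_⟩⟩
  · rw [(hn.2.2 k).2]
    exact (Finset.mem_Icc.mp (Fintype.mem_piFinset.mp hj k)).1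
  · rw [(hn.2.2 k).2]
    exact (Finset.mem_Icc.mp (Fintype.mem_piFinset.mp hj k)).2

/-! ## (c) The physical degree: `U(N) = 4` below `exp(exp 4)` -/

/-- `U(N) = 4` as soon as `log log N < 4`. -/
theorem slowDegree_eq_four_of_log {N : ℕ} (hN : Real.log (Real.log N) < 4) : slowDegree N = 4 := by
  unfold slowDegree
  have hs : Real.sqrt (Real.log (Real.log N)) < 2 := by
    rw [Real.sqrt_lt' two_pos]
    linarith
  have hfloor : ⌊Real.sqrt (Real.log (Real.log N)) / 2⌋₊ = 0 := by
    rw [Nat.floor_eq_zero]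
    linarith
  rw [hfloor]
  rfl

/-- `U(N) = 4` for every `N ≤ 2^78 ≈ 3·10²³` (`78 log 2 < 54.1 < e^4`).  Every fibre ever computed for this crux
(`N ≤ 10¹⁰`) is a degree-`4` fibre. -/
theorem slowDegree_eq_four_of_le {N : ℕ} (hN : N ≤ 2 ^ 78) : slowDegree N = 4 := by
  apply slowDegree_eq_four_of_log
  have hlog2 := Real.log_two_lt_d9
  have he : (54.1 : ℝ) < Real.exp 4 := by
    have h1 := Real.exp_one_gt_d9
    have : Real.exp 4 = Real.exp 1 ^ 4 := by rw [← Real.exp_nat_mul]; norm_num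
    rw [this]
    have h2 : (2.7182818283 : ℝ) ^ 4 ≤ Real.exp 1 ^ 4 := pow_le_pow_left₀ (by norm_num) h1.le 4
    have h3 : (54.1 : ℝ) < (2.7182818283 : ℝ) ^ 4 := by norm_num
    exact h3.trans_le h2
  -- log N ≤ 78 log 2 < 54.1 < exp 4
  have hlogN : Real.log N < Real.exp 4 := by
    rcases Nat.eq_zero_or_pos N with rfl | hpos
    · simp; positivity
    · have : Real.log N ≤ Real.log ((2 : ℝ) ^ 78) := by
        apply Real.log_le_log (by exact_mod_cast hpos)
        exact_mod_cast hN
      rw [Real.log_pow] at this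
      push_cast at this
      linarith
  -- hence log log N < 4
  rcases le_or_gt (Real.log N) 0 with hle | hpos
  · have h0 : Real.log N = 0 := le_antisymm hle (Real.log_natCast_nonneg N)
    rw [h0, Real.log_zero]
    norm_num
  · calc Real.log (Real.log N) < Real.log (Real.exp 4) := Real.log_lt_log hpos hlogN
      _ = 4 := Real.log_exp 4

/-- Consequently, for `N ≤ 2^78` the crux's fibre is the degree-`4` fibre of the fixed-degree crux at `u = 4`. -/
theorem fibre_along_eq_fibre_four {N : ℕ} (hN : N ≤ 2 ^ 78) (t : ℕ) (Ψ : Fin t → AffLinForm 1)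
    (K : Set (Fin 1 → ℝ)) (i : Fin t) (w : Fin t → ℝ) (ζ : ℂ) :
    fibre t N (slowDegree N) Ψ K i w ζ = fibre t N 4 Ψ K i w ζ := by
  rw [slowDegree_eq_four_of_le hN]


/-- Sharper: `U(N) = 4` iff the floor term is `≤ 4`, in particular whenever `log log N < 100`, i.e. for every
`N < exp(exp 100)` — the route's "U = 4 for every N < exp(exp(100))". -/
theorem slowDegree_eq_four_of_loglog_lt {N : ℕ} (hN : Real.log (Real.log N) < 100) : slowDegree N = 4 := by
  unfold slowDegree
  have hs : Real.sqrt (Real.log (Real.log N)) < 10 := by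
    rw [Real.sqrt_lt' (by norm_num : (0 : ℝ) < 10)]
    linarith
  have hfloor : ⌊Real.sqrt (Real.log (Real.log N)) / 2⌋₊ ≤ 4 := by
    have : ⌊Real.sqrt (Real.log (Real.log N)) / 2⌋₊ < 5 := by
      rw [Nat.floor_lt (by positivity)]
      push_cast
      linarith
    omega
  exact max_eq_left hfloor

/-- Conversely `U(N) ≥ 5` forces `log log N ≥ 100`. -/
theorem loglog_ge_of_five_le_slowDegree {N : ℕ} (h : 5 ≤ slowDegree N) : 100 ≤ Real.log (Real.log N) := by
  by_contra hlt
  push Not at hlt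
  have := slowDegree_eq_four_of_loglog_lt hlt
  omega

/-! ## (d) Necessity at `t = 1`: the model row ALONG THE SCHEDULE (parity-free, open in the tree)

The `t = 1` instance `ψ(n) = n`, `K = [0, N]`, `η = 1` (`β_∞ = N`, `𝔖 = 1`; fixed-degree file
`Cruxes/FibreHyperbolicity/Disproof.lean`) has as fibre EXACTLY the rough-integer cell polynomial `Σ_{j ≤ U(N)} A_j(N) z^j`
of `ModelHyperbolicity`, now at the scheduled degree `u = U(N)`.  So the crux implies `ModelRowAlong` below.  Status:
for `N < exp(exp 100)` its content is "`Σ_{j≤4} A_j(N) z^j` real-rooted", which the PROVED `ModelHyperbolicity`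
(`WindowChainTransport.ModelHyperbolicity_of`, u = 4) gives from some ineffective `x₀(4)` on (numerically `x₀(4) = 481`,
exhaustive to `10⁷`, kit j014034; real at `10⁸, 10⁹, 10¹⁰`); beyond, it asks `x₀(u) ≤ exp(exp(4u²))`-type effectivity
(route: NOT DECOMPOSED YET; the strategist's `RobustRowExp` + `AnatomyAlong` would supply it).  A parity-free OPEN
necessary condition — the only place where a STRUCTURAL (non-HL) kill could in principle live, and numerically dead:
the Buchstab–Dickman row `F_u` is real-rooted for every `u ≤ 300` with robustness `θ*(u) ≈ 6·10^{−0.41u}` while the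
finite-`N` secondary terms along the schedule are `O(e^{−4U²}) = O((log N)^{−1})` (kit j013962/j014024, census §0). -/

/-- The rough-integer Ω-row is real-rooted along the schedule (the `t = 1`, `ψ(n) = n`, `K = [0,N]` instance). -/
def ModelRowAlong : Prop :=
  ∃ N₀ : ℕ, ∀ N : ℕ, N₀ ≤ N → ∀ z : ℂ,
    (∑ j ∈ Finset.range (slowDegree N + 1), ((modelCell (slowDegree N) N j : ℕ) : ℂ) * z ^ j) = 0 → z.im = 0

/-- **The crux implies the model row along the schedule** (its `t = 1` model instance). [folklore] -/
theorem modelRowAlong_of_along (h : FibreHyperbolicityAlong) : ModelRowAlong := by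
  obtain ⟨N₀, hN⟩ := h 1 1 le_rfl 1 one_pos
  refine ⟨max N₀ 1, fun x hx z hz => ?_⟩
  have hxN : N₀ ≤ x := le_trans (le_max_left _ _) hx
  have hx1 : 1 ≤ x := le_trans (le_max_right _ _) hx
  refine hN x hxN idSys idSys_isNondegenerate (by rw [affLinSize_idSys]; simp) (boxK x)
    (convex_boxK x) (boxK_subset_realBox x) (archMass_idSys_boxK x) 0 (fun _ => 1)
    (fun _ => ⟨one_pos, le_rfl⟩) z ?_
  change Cruxes.FibreHyperbolicity.Disproof.fibre 1 (slowDegree x) x idSys (boxK x) 0 (fun _ => 1) z = 0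
  rw [← model_sum_eq_fibre (slowDegree x) x hx1 z]
  exact hz

/-- Contrapositive (kill criterion along the schedule, formal): non-real zeros of `Σ_{j ≤ U(N)} A_j(N) z^j` at
arbitrarily large `N` refute the crux. -/
theorem not_along_of_not_modelRowAlong (h : ¬ ModelRowAlong) : ¬ FibreHyperbolicityAlong :=
  fun hA => h (modelRowAlong_of_along hA)


/-! ## (f) Numerics of this seat — FAMILY SCAN at the physical degree (kit j026011, N = 10⁸; smoke j025795, N = 10⁶)

Script `kit/fibres_family_scan.py` (numpy sieve of `P⁻` and `Ω` to `3.3N`, sanity 3000/3000 against trial division,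
`A_j(10⁸) = (5761430, 5710616, 557406, 0)` = census values; EXACT integer discriminants; self-test on the `N = 130` toy
pattern).  For each system and window the joint cells `C_j`, `j ∈ [1,4]^t`, and EVERY fibre (each coordinate free; the
other fugacities on the grid `w ∈ {0⁺ (prime-column limit), .001, .01, .05, .1, .2, …, .9, 1}` for `t = 2`, `8`-point
grid for `t = 3`, `4`-point for `t = 4`).  `fibre/ζ = c₁ + c₂ζ + c₃ζ² + c₄ζ³`; `ρ := c₂²/(4c₁c₃)` (for `c₄ = 0`
real-rooted iff `ρ ≥ 1`; HL-limit `2.035`); for `c₄ > 0` the cubic discriminant decides (all were `> 0`,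
normalised `Δ/(c₂²c₃²) ∈ [0.40, 0.58]`).  Windows: full `n`-range, 10 deciles, 100 centiles, and for 9 systems all
4950 unions of ≥ 2 consecutive centiles.  43 systems at `N = 10⁸`:
`t = 1`: `n`, `n+N`, `n+2N` (values to `3N`), `2n+1`, `3n+1`, `3n+2`, `7n+3`;
`t = 2`: `(n, n+h)`, `h ∈ {2,4,6,8,10,12,16,30,210,2310,30030,510510,9699690,223092870 (= 23#, 𝔖 maximal), N/2, N−2}`,
Goldbach `(n, M−n)`, `M ∈ {N, N+2, 2N, 23#}`, `(n,2n±1)`, `(n,3n+2)`, `(2n+1,3n+1)`, `(n,3n−2)`, high scale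
`(n+N, n+N+2)`, `(n+2N, n+2N+6)`, mixed `(n, n+N+2)`;  `t = 3`: `(n,n+2,n+6)`, `(n,n+4,n+6)`, `(n,n+6,n+12)`,
Cunningham `(n,2n+1,4n+3)`, `(n,n+2,N−n)`, `(n+N,n+N+2,n+N+6)`;  `t = 4`: `(n,n+2,n+6,n+8)`, `(n,n+4,n+6,n+10)`.

RESULT (`N = 10⁸`, 1 356 555 fibres): full windows 0/2455 non-real, deciles 0/24550, centile-unions 0/693000,
centiles 94/245500 — ALL 94 in the two quadruple systems, in centiles holding ≤ 1802 rough 4-tuples (`t = 4` cells of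
size ≲ 10`²`: the `N = 130` noise regime).  Margins (min `ρ` over all fibres of the window class):

| family (N = 10⁸)                         | rough tuples | full ρ | deciles | centiles | unions |
|------------------------------------------|-------------:|-------:|--------:|---------:|-------:|
| `n` on `[1,N]` (model row, t = 1)        | 1.2·10⁷      | 2.539  | 2.081   | 2.040    | 2.059  |
| `n + N`, `n + 2N` (values to 3N; cubic)  | 1.2·10⁷      | 1.915 / 1.754 | 1.83 / 1.71 | 1.80 / 1.68 | 1.81 / 1.69 |
| `(n, n+h)`, h ≤ 510510 (13 shifts)       | 1.9–7.9·10⁶  | 2.530–2.543 | ≥ 2.009 | ≥ 1.848 | 1.960 (h=2) |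
| `(n, n+23#)` (values to 3.2N; cubic)     | 8.8·10⁶      | 1.720  | 1.680   | 1.607    | 1.637  |
| Goldbach `(n, M−n)`, M = N, N+2          | 2.6–4.1·10⁶  | 2.50–2.51 | ≥ 2.06 | ≥ 1.93  | 2.010  |
| Goldbach M = 2N, 23#;  `(n, n+N/2)`, `(n, n+N−2)` | 2.4–8.8·10⁶ | 1.85–2.06 | ≥ 1.77 | ≥ 1.61 | —  |
| non-monic `(n,2n±1)`, `(n,3n±2)`, `(2n+1,3n+1)` | 1.9–3.8·10⁶ | 1.985–2.159 | ≥ 1.698 | ≥ 1.590 | 1.718 (SG) |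
| high scale `(n+N,n+N+2)`, `(n+2N,n+2N+6)` | 1.9–3.8·10⁶ | 1.914 / 1.747 | ≥ 1.683 | ≥ 1.561 | 1.707 |
| triples (6 systems)                      | 4.1–10·10⁵   | 1.871–2.535 | ≥ 1.606 | ≥ 1.260 | 1.692 |
| quadruples (2 systems)                   | 0.9–1.8·10⁵  | 2.42–2.48 | ≥ 1.659 | FAIL ≤ 1802 tuples | — |

Readings.  (1) No non-real fibre anywhere with more than `1.8·10³` rough tuples in the window; the physical-degree
kill criterion of the route (a complex pair at growing `N` for an admissible system) does not fire on any of 43 families.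
(2) NEW: the families whose values reach `(N, 3N]` — large shifts, Goldbach with `M > N`, non-monic forms, translated
systems — sit at `ρ ≈ 1.7–2.0`, BELOW the classical `2.5` and below the HL limit `2.035`: their effective roughness
parameter is `u_eff = 4 log x/log N ∈ (4, 4.25]`, the local Ω-row is the cubic `F_{u_eff}` (top cell inhabited,
`I₃` enhanced), and the finite-`N` deviation from the `u = 4` limit has the OPPOSITE sign to the `≤ N` families; both
converge to `2.035` as `log(L+1)/log N → 0`.  So the uniformity in `L` costs margin at finite `N` (the worst admissible
family at scale `N` is the one with the largest values), but the cubic discriminants stay positive by a factor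
`≈ 0.4 c₂²c₃²` — no approach to the threshold.  (3) `N = 10⁶` smoke (same 41 families): full windows 0/2371, deciles
87/23710 (all in `t ≥ 3` windows with ≤ 240 tuples), centiles 6 % (≤ 632 tuples): the noise boundary scales like a
few hundred rough tuples per window, independently of `t` and of the family.  (4) `N = 10⁹` subset (kit j026173):
appended below when delivered. -/

end Summit.Parity.GeneralizedHardyLittlewood.Cruxes.FibreHyperbolicityAlong.Disproof

end
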